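import Mathlib
import Literature.Analysis.FluidPDE.CompressibleEulerImplosionMonatomicHolds

/-!
# The pinned BCG profile, I: the global `(W, Z)` orbit of the successful shooting WITH its sonic data
# (crux `DenseExcursion`, line `sonic-cavity-renewal`, brick towards `stub_boxPackage`)

Helper file (`--supports stmt-AtomisticToContinuum-12586`) for the registered stub `stub_boxPackage` of the line
`sonic-cavity-renewal` of the crux `Summit.AtomisticToContinuum.HydrodynamicLimit.Theses.ImplosionDichotomy.DenseExcursion`.

The Literature layer proves Theorem 1.1 of Buckmaster–Cao-Labora–Gómez-Serrano at `γ = 5/3`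
(`BuckmasterCaolaboraGomezserrano2025_thm11_monatomic_holds`) by gluing the `P₀` trajectory, the analytic branch
through the sonic point `P_s` and its certified continuation to `P_∞` (`Monatomic.thm11_monatomic_of_meeting`,
`Shooting.exists_meeting`, `Monatomic.leftData_all`), but the named fact it lands is an opaque existential which
FORGETS (i) that the meeting speed lies in the kernel-certified shooting window `[r_d, r_u] = [17307/15625, 89409/80000]`
and (ii) where the sonic point sits and the sign of `D_Z = 1 + (W + 2Z)/3` on either side of it. Both are needed by
the `CavityTube` of the line (`…SonicCavityDefs`). This file re-runs the glue with the richer conclusion: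

* `globalWZ_of_meeting` — adapted from `Monatomic.thm11_monatomic_of_meeting` (`CompressibleEulerImplosionShootingGlue.lean`,
  same hypotheses, same construction `P = c | branch | continuation`): the global smooth solution `(W, Z)` of (1.8) with
  `Z < W`, limits `P_∞`, the origin germ, AND: near `T₀ = ξm − s` it IS the analytic branch `(W^{(r)}, Z^{(r)})(· − T₀)`,
  `D_Z < 0` for `ξ < T₀`, `D_Z > 0` for `ξ > T₀`;
* `exists_meetingWZ` — fed with `Shooting.exists_meeting` and `Monatomic.leftData_all`: such an orbit exists for some
  `r ∈ [r_d, r_u]`, with origin germ the explicit origin series `OriginSeries.profile r 1`.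

The sequel (`…SonicPinnedProfile.lean`) shifts `T₀` to `0` and passes to the line's variables `W = −(W+Z)/2`,
`S = (W−Z)/6`, in which `W + S = 1 − D_Z`.
-/

noncomputable section

open Set Filter Metric Topology
open scoped ContDiff

namespace Summit.AtomisticToContinuum.HydrodynamicLimit.Theorems.SonicCavityRenewal

open Literature.Analysis.FluidPDE.BuckmasterCaolaboraGomezserrano2025
open Literature.Analysis.FluidPDE.BuckmasterCaolaboraGomezserrano2025.Monatomic
open Literature.Analysis.FluidPDE.BuckmasterCaolaboraGomezserrano2025.Monatomic.SonicSeries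

-- adapted from Literature/Analysis/FluidPDE/CompressibleEulerImplosionShootingGlue.lean (`thm11_monatomic_of_meeting`)
/-- **The global orbit of a successful shooting, with its sonic data.** Let `r ∈ (r₃, r₄)`. Suppose the `P₀`
trajectory `c` (origin germ `𝒲`, analytic at `0`, `𝒲 0 > 0`) solves (1.8) on `(−∞, T)` off the sonic lines with
`D_W > 0`, `D_Z < 0`, `Z < W`, meets at `ξm` the analytic branch through `P_s` at branch time `s < 0` (the branch
being off the sonic lines with `D_Z < 0`, `Z < W` on `[s, 0)`), and the branch continues for positive branch times as
`(Wl, Zl)` with `D_W, D_Z > 0`, `Zl < Wl`, tending to `P_∞`. Then there is a global `C^∞` solution `(W, Z)` of (1.8)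
(multiplied form) with `Z < W`, `(W, Z) → (0, 0)`, reproducing the origin germ on `(0, e^{ξ₁})`, which near
`T₀ = ξm − s` coincides with the shifted branch `(W^{(r)}, Z^{(r)})(· − T₀)` and has `D_Z < 0` before `T₀` and
`D_Z > 0` after `T₀` (the sonic point `P_s` is crossed exactly once, at `ξ = T₀`).
[cite: BuckmasterCaolaboraGomezserrano2025, §6 (proof of Theorem 1.1), Prop. 2.3, Prop. 2.5, Prop. 3.1] -/
theorem globalWZ_of_meeting {r : ℝ} (h3 : r3 < r) (h4 : r < r4)
    {𝒲 : ℝ → ℝ} {c : ℝ → ℝ × ℝ} {ξ₁ ξm T : ℝ} (hξ₁ : ξ₁ < ξm) (hT : ξm < T)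
    (hgerm : ∀ ξ : ℝ, ξ ≤ ξ₁ → c ξ = (WofProfile 𝒲 ξ, ZofProfile 𝒲 ξ))
    (hc : ∀ ξ ∈ Iio T, HasDerivAt c (field r (c ξ)) ξ)
    (hoff : ∀ ξ ∈ Iio T, 0 < DW (c ξ).1 (c ξ).2 ∧ DZ (c ξ).1 (c ξ).2 < 0 ∧ (c ξ).2 < (c ξ).1)
    {s : ℝ} (hs : s < 0) (hsρ : |s| < sonicRad r) (hmeet : c ξm = (Wloc r s, Zloc r s))
    (hsonic : ∀ t ∈ Ico s 0,
      0 < DW (Wloc r t) (Zloc r t) ∧ DZ (Wloc r t) (Zloc r t) < 0 ∧ Zloc r t < Wloc r t)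
    {Wl Zl : ℝ → ℝ} {δ : ℝ} (hδ : 0 < δ)
    (hbranch : ∀ t ∈ Ico 0 δ, Wl t = Wloc r t ∧ Zl t = Zloc r t)
    (hl : ∀ t ∈ Ioi (0 : ℝ), HasDerivAt (fun x => (Wl x, Zl x)) (field r (Wl t, Zl t)) t)
    (hloff : ∀ t ∈ Ioi (0 : ℝ), 0 < DW (Wl t) (Zl t) ∧ 0 < DZ (Wl t) (Zl t) ∧ Zl t < Wl t)
    (hlimW : Tendsto Wl atTop (𝓝 0)) (hlimZ : Tendsto Zl atTop (𝓝 0)) :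
    ∃ W Z : ℝ → ℝ, ContDiff ℝ ∞ W ∧ ContDiff ℝ ∞ Z ∧
      (∀ ξ, DW (W ξ) (Z ξ) * deriv W ξ = NW r (W ξ) (Z ξ) ∧
        DZ (W ξ) (Z ξ) * deriv Z ξ = NZ r (W ξ) (Z ξ)) ∧
      (∀ ξ, Z ξ < W ξ) ∧ Tendsto W atTop (𝓝 0) ∧ Tendsto Z atTop (𝓝 0) ∧
      (∀ ζ ∈ Ioo 0 (Real.exp ξ₁), ζ * W (Real.log ζ) = 𝒲 ζ ∧ -ζ * Z (Real.log ζ) = 𝒲 (-ζ)) ∧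
      (W =ᶠ[𝓝 (ξm - s)] fun x => Wloc r (x - (ξm - s))) ∧
      (Z =ᶠ[𝓝 (ξm - s)] fun x => Zloc r (x - (ξm - s))) ∧
      (∀ ξ, ξ < ξm - s → DZ (W ξ) (Z ξ) < 0) ∧ (∀ ξ, ξm - s < ξ → 0 < DZ (W ξ) (Z ξ)) := by
  have hm := r3_r4_mem
  have hr2 : r < 2 := by linarith [rstar_lt, h4.trans hm.2.2]
  obtain ⟨hW0, hZ0, _, _, hspec⟩ := sonicSeries_spec' h3 h4
  -- the branch, shifted so that branch time `t` corresponds to `ξ = T₀ + t`, `T₀ = ξm - s`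
  set T₀ : ℝ := ξm - s with hT₀
  set δ' : ℝ := min δ (sonicRad r) / 2 with hδ'
  have hδ'pos : 0 < δ' := by
    have := sonicRad_pos (h4.trans hm.2.2); positivity
  have hδ'δ : δ' < δ := by
    have := min_le_left δ (sonicRad r); simp only [hδ']; linarith
  have hδ'ρ : δ' < sonicRad r := by
    have := min_le_right δ (sonicRad r); simp only [hδ']; linarith
  set B : ℝ → ℝ × ℝ := fun x => (Wloc r (x - T₀), Zloc r (x - T₀)) with hB
  set L : ℝ → ℝ × ℝ := fun x => (Wl (x - T₀), Zl (x - T₀)) with hL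
  set P : ℝ → ℝ × ℝ := fun x => if x < ξm then c x else if x < T₀ + δ' then B x else L x with hP
  -- local uniqueness at the meeting time: `c = B` near `ξm`
  have hBm : B ξm = c ξm := by
    rw [hmeet]; simp only [hB]; congr 1 <;> congr 1 <;> simp only [hT₀] <;> ring
  have hcB : c =ᶠ[𝓝 ξm] B := by
    have h₁ : ∀ᶠ t in 𝓝 ξm, HasDerivAt c (field r (c t)) t :=
      Filter.eventually_of_mem (Iio_mem_nhds hT) fun t ht => hc t ht
    have hsρ' : |ξm - T₀| < sonicRad r := by simp only [hT₀]; rwa [show ξm - (ξm - s) = s by ring]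
    have hcontB : ContinuousAt B ξm := by
      have hW := ((hspec _ hsρ').1.continuousAt).comp (f := fun x : ℝ => x - T₀)
        (continuousAt_id.sub continuousAt_const)
      have hZ := ((hspec _ hsρ').2.1.continuousAt).comp (f := fun x : ℝ => x - T₀)
        (continuousAt_id.sub continuousAt_const)
      exact hW.prodMk hZ
    have hoffm := hoff ξm hT
    rw [← hBm] at hoffm
    have hc1 : ContinuousAt (fun t => (B t).1) ξm := hcontB.fst
    have hc2 : ContinuousAt (fun t => (B t).2) ξm := hcontB.snd
    have hDWc : ContinuousAt (fun t => DW (B t).1 (B t).2) ξm := by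
      unfold DW
      exact continuousAt_const.add (((continuousAt_const.mul hc1).add hc2).div_const 3)
    have hDZc : ContinuousAt (fun t => DZ (B t).1 (B t).2) ξm := by
      unfold DZ
      exact continuousAt_const.add ((hc1.add (continuousAt_const.mul hc2)).div_const 3)
    have hDWev : ∀ᶠ t in 𝓝 ξm, DW (B t).1 (B t).2 ≠ 0 := hDWc.eventually_ne hoffm.1.ne'
    have hDZev : ∀ᶠ t in 𝓝 ξm, DZ (B t).1 (B t).2 ≠ 0 := hDZc.eventually_ne hoffm.2.1.ne
    have hρev : ∀ᶠ t in 𝓝 ξm, |t - T₀| < sonicRad r :=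
      (continuous_abs.continuousAt.comp (continuousAt_id.sub continuousAt_const)).eventually_lt
        continuousAt_const hsρ'
    have h₂ : ∀ᶠ t in 𝓝 ξm, HasDerivAt B (field r (B t)) t := by
      filter_upwards [hDWev, hDZev, hρev] with t hDW hDZ hρt
      exact (hasDerivAt_branch h3 h4 hρt hDW hDZ).comp_sub_const t T₀
    exact eventuallyEq_of_field h₁ h₂ ⟨(hoff ξm hT).1.ne', (hoff ξm hT).2.1.ne⟩ hBm.symm
  -- local representations of `P`
  have hT₀m : ξm < T₀ + δ' := by simp only [hT₀]; linarith
  have hT₀ξm : ξm < T₀ := by simp only [hT₀]; linarith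
  have repr_c : ∀ ξ, ξ < ξm → P =ᶠ[𝓝 ξ] c := fun ξ hξ =>
    Filter.eventually_of_mem (Iio_mem_nhds hξ) fun x hx => by
      simp only [hP, if_pos (mem_Iio.mp hx)]
  have repr_B : ∀ ξ, ξm ≤ ξ → ξ < T₀ + δ' → P =ᶠ[𝓝 ξ] B := by
    intro ξ h1 h2
    rcases eq_or_lt_of_le h1 with heq | hlt
    · rw [← heq]
      have e2 : ∀ᶠ x in 𝓝 ξm, x < T₀ + δ' := Iio_mem_nhds hT₀m
      filter_upwards [hcB, e2] with x hx1 hx2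
      by_cases hx : x < ξm
      · simp only [hP, if_pos hx]; exact hx1
      · simp only [hP, if_neg hx, if_pos hx2]
    · filter_upwards [Ioo_mem_nhds hlt h2] with x hx
      simp only [hP, if_neg (not_lt.mpr hx.1.le), if_pos hx.2]
  have repr_L : ∀ ξ, T₀ + δ' ≤ ξ → P =ᶠ[𝓝 ξ] L := by
    intro ξ h1
    have e : ∀ᶠ x in 𝓝 ξ, T₀ < x := Ioi_mem_nhds (by linarith)
    filter_upwards [e] with x hx
    by_cases hx1 : x < ξm
    · exfalso; linarith
    · by_cases hx2 : x < T₀ + δ'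
      · simp only [hP, if_neg hx1, if_pos hx2, hB, hL]
        have hb := hbranch (x - T₀) ⟨by linarith, by linarith⟩
        rw [hb.1, hb.2]
      · simp only [hP, if_neg hx1, if_neg hx2]
  -- facts about the three representatives
  have hD : ∀ ξ ∈ Iio T, DW (c ξ).1 (c ξ).2 ≠ 0 ∧ DZ (c ξ).1 (c ξ).2 ≠ 0 := fun ξ hξ =>
    ⟨(hoff ξ hξ).1.ne', (hoff ξ hξ).2.1.ne⟩
  set cl : ℝ → ℝ × ℝ := fun x => (Wl x, Zl x) with hcl
  have hlD : ∀ t ∈ Ioi (0 : ℝ), DW (cl t).1 (cl t).2 ≠ 0 ∧ DZ (cl t).1 (cl t).2 ≠ 0 := fun t ht =>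
    ⟨(hloff t ht).1.ne', (hloff t ht).2.1.ne'⟩
  have hl' : ∀ t ∈ Ioi (0 : ℝ), HasDerivAt cl (field r (cl t)) t := fun t ht => hl t ht
  -- branch-time bounds in the middle region
  have hmid : ∀ ξ, ξm ≤ ξ → ξ < T₀ + δ' → s ≤ ξ - T₀ ∧ ξ - T₀ < δ' ∧ |ξ - T₀| < sonicRad r := by
    intro ξ h1 h2
    have k1 : s ≤ ξ - T₀ := by simp only [hT₀]; linarith
    have k2 : ξ - T₀ < δ' := by linarith
    refine ⟨k1, k2, abs_lt.mpr ⟨?_, by linarith⟩⟩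
    have : -sonicRad r < s := (abs_lt.mp hsρ).1
    linarith
  -- the global solution
  set W : ℝ → ℝ := fun x => (P x).1 with hWdef
  set Z : ℝ → ℝ := fun x => (P x).2 with hZdef
  have evW : ∀ {ξ : ℝ} {R : ℝ → ℝ × ℝ}, P =ᶠ[𝓝 ξ] R → W =ᶠ[𝓝 ξ] fun x => (R x).1 :=
    fun h => h.mono fun x hx => by simp only [hWdef, hx]
  have evZ : ∀ {ξ : ℝ} {R : ℝ → ℝ × ℝ}, P =ᶠ[𝓝 ξ] R → Z =ᶠ[𝓝 ξ] fun x => (R x).2 :=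
    fun h => h.mono fun x hx => by simp only [hZdef, hx]
  -- (1)+(2)+(3'): smoothness, the equations, `Z < W` and the sign of `D_Z`, pointwise
  have key : ∀ ξ : ℝ, (ContDiffAt ℝ ∞ W ξ ∧ ContDiffAt ℝ ∞ Z ξ) ∧
      (DW (W ξ) (Z ξ) * deriv W ξ = NW r (W ξ) (Z ξ) ∧
       DZ (W ξ) (Z ξ) * deriv Z ξ = NZ r (W ξ) (Z ξ)) ∧ Z ξ < W ξ ∧
      (ξ < T₀ → DZ (W ξ) (Z ξ) < 0) ∧ (T₀ < ξ → 0 < DZ (W ξ) (Z ξ)) := by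
    intro ξ
    rcases lt_or_ge ξ ξm with h1 | h1
    · -- region of `c`
      have hrep := repr_c ξ h1
      have hξT : ξ ∈ Iio T := h1.trans hT
      obtain ⟨sW, sZ, eW, eZ⟩ := smooth_of_field isOpen_Iio hc hD hξT
      have hWv : W ξ = (c ξ).1 := by simp only [hWdef, hrep.self_of_nhds]
      have hZv : Z ξ = (c ξ).2 := by simp only [hZdef, hrep.self_of_nhds]
      refine ⟨⟨sW.congr_of_eventuallyEq (evW hrep), sZ.congr_of_eventuallyEq (evZ hrep)⟩, ⟨?_, ?_⟩, ?_,
        fun _ => ?_, fun h => absurd (h1.trans hT₀ξm) (not_lt.mpr h.le)⟩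
      · rw [(evW hrep).deriv_eq, hWv, hZv]; exact eW
      · rw [(evZ hrep).deriv_eq, hWv, hZv]; exact eZ
      · rw [hWv, hZv]; exact (hoff ξ hξT).2.2
      · rw [hWv, hZv]; exact (hoff ξ hξT).2.1
    · rcases lt_or_ge ξ (T₀ + δ') with h2 | h2
      · -- region of the analytic branch
        have hrep := repr_B ξ h1 h2
        obtain ⟨k1, k2, k3⟩ := hmid ξ h1 h2
        obtain ⟨hanW, hanZ, heW, heZ⟩ := hspec (ξ - T₀) k3
        have hWv : W ξ = Wloc r (ξ - T₀) := by simp only [hWdef, hrep.self_of_nhds, hB]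
        have hZv : Z ξ = Zloc r (ξ - T₀) := by simp only [hZdef, hrep.self_of_nhds, hB]
        have hshift : ContDiffAt ℝ ∞ (fun x : ℝ => x - T₀) ξ := contDiffAt_id.sub contDiffAt_const
        have cW := hanW.contDiffAt.comp ξ hshift
        have cZ := hanZ.contDiffAt.comp ξ hshift
        have hposb : 0 < ξ - T₀ → Wloc r (ξ - T₀) = Wl (ξ - T₀) ∧ Zloc r (ξ - T₀) = Zl (ξ - T₀) :=
          fun ht => by
            have hb := hbranch (ξ - T₀) ⟨ht.le, k2.trans hδ'δ⟩
            exact ⟨hb.1.symm, hb.2.symm⟩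
        refine ⟨⟨?_, ?_⟩, ⟨?_, ?_⟩, ?_, fun hlt => ?_, fun hgt => ?_⟩
        · exact cW.congr_of_eventuallyEq (evW hrep)
        · exact cZ.congr_of_eventuallyEq (evZ hrep)
        · rw [(evW hrep).deriv_eq, hWv, hZv]
          simp only [hB]
          rw [deriv_comp_sub_const]; exact heW
        · rw [(evZ hrep).deriv_eq, hWv, hZv]
          simp only [hB]
          rw [deriv_comp_sub_const]; exact heZ
        · rw [hWv, hZv]
          rcases lt_trichotomy (ξ - T₀) 0 with ht | ht | ht
          · exact (hsonic _ ⟨k1, ht⟩).2.2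
          · rw [ht, hW0, hZ0]; unfold W0 Z0; linarith [q_nonneg r]
          · rw [(hposb ht).1, (hposb ht).2]; exact (hloff _ ht).2.2
        · rw [hWv, hZv]
          exact (hsonic _ ⟨k1, by linarith⟩).2.1
        · rw [hWv, hZv]
          have ht : 0 < ξ - T₀ := by linarith
          rw [(hposb ht).1, (hposb ht).2]; exact (hloff _ ht).2.1
      · -- region of the continuation `(Wl, Zl)`
        have hrep := repr_L ξ h2
        have ht : ξ - T₀ ∈ Ioi (0 : ℝ) := by rw [Set.mem_Ioi]; linarith
        obtain ⟨sW, sZ, eW, eZ⟩ := smooth_of_field isOpen_Ioi hl' hlD ht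
        have hWv : W ξ = Wl (ξ - T₀) := by simp only [hWdef, hrep.self_of_nhds, hL]
        have hZv : Z ξ = Zl (ξ - T₀) := by simp only [hZdef, hrep.self_of_nhds, hL]
        have hshift : ContDiffAt ℝ ∞ (fun x : ℝ => x - T₀) ξ := contDiffAt_id.sub contDiffAt_const
        have cW : ContDiffAt ℝ ∞ (fun x => Wl (x - T₀)) ξ := sW.comp ξ hshift
        have cZ : ContDiffAt ℝ ∞ (fun x => Zl (x - T₀)) ξ := sZ.comp ξ hshift
        refine ⟨⟨?_, ?_⟩, ⟨?_, ?_⟩, ?_, fun h => absurd h (not_lt.mpr (by linarith)), fun _ => ?_⟩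
        · exact cW.congr_of_eventuallyEq (evW hrep)
        · exact cZ.congr_of_eventuallyEq (evZ hrep)
        · rw [(evW hrep).deriv_eq, hWv, hZv]
          simp only [hL]
          rw [deriv_comp_sub_const]; exact eW
        · rw [(evZ hrep).deriv_eq, hWv, hZv]
          simp only [hL]
          rw [deriv_comp_sub_const]; exact eZ
        · rw [hWv, hZv]; exact (hloff _ ht).2.2
        · rw [hWv, hZv]; exact (hloff _ ht).2.1
  have hWsm : ContDiff ℝ ∞ W := contDiff_iff_contDiffAt.mpr fun ξ => (key ξ).1.1
  have hZsm : ContDiff ℝ ∞ Z := contDiff_iff_contDiffAt.mpr fun ξ => (key ξ).1.2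
  -- (4) limits
  have hevL : ∀ᶠ x in atTop, P x = L x := by
    filter_upwards [eventually_ge_atTop (T₀ + δ')] with x hx
    exact (repr_L x hx).self_of_nhds
  have hshiftT : Tendsto (fun x : ℝ => x - T₀) atTop atTop :=
    (tendsto_atTop_add_const_right atTop (-T₀) tendsto_id).congr fun x => by
      simp only [id, sub_eq_add_neg]
  have hlimW' : Tendsto W atTop (𝓝 0) := by
    refine (hlimW.comp hshiftT).congr' ?_
    filter_upwards [hevL] with x hx
    simp only [hWdef, hx, hL, Function.comp_apply]
  have hlimZ' : Tendsto Z atTop (𝓝 0) := by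
    refine (hlimZ.comp hshiftT).congr' ?_
    filter_upwards [hevL] with x hx
    simp only [hZdef, hx, hL, Function.comp_apply]
  -- (5) the origin germ
  have horigin : ∀ ζ ∈ Ioo 0 (Real.exp ξ₁),
      ζ * W (Real.log ζ) = 𝒲 ζ ∧ -ζ * Z (Real.log ζ) = 𝒲 (-ζ) := by
    intro ζ hζ
    have hlog : Real.log ζ < ξ₁ := by
      rw [Real.log_lt_iff_lt_exp hζ.1]; exact hζ.2
    have hPc : P (Real.log ζ) = c (Real.log ζ) := (repr_c _ (hlog.trans hξ₁)).self_of_nhds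
    have hcg := hgerm (Real.log ζ) hlog.le
    have hWv : W (Real.log ζ) = WofProfile 𝒲 (Real.log ζ) := by simp only [hWdef, hPc, hcg]
    have hZv : Z (Real.log ζ) = ZofProfile 𝒲 (Real.log ζ) := by simp only [hZdef, hPc, hcg]
    rw [hWv, hZv]
    unfold WofProfile ZofProfile
    rw [Real.exp_neg, Real.exp_log hζ.1]
    have hζ0 : ζ ≠ 0 := hζ.1.ne'
    constructor
    · field_simp
    · field_simp
  -- (6) the sonic point: near `T₀` the solution is the shifted branch
  have hrep₀ := repr_B T₀ hT₀ξm.le (by linarith)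
  refine ⟨W, Z, hWsm, hZsm, fun ξ => (key ξ).2.1, fun ξ => (key ξ).2.2.1, hlimW', hlimZ', horigin,
    (evW hrep₀).trans (Eventually.of_forall fun x => by simp only [hB]),
    (evZ hrep₀).trans (Eventually.of_forall fun x => by simp only [hB]),
    fun ξ hξ => (key ξ).2.2.2.1 hξ, fun ξ hξ => (key ξ).2.2.2.2 hξ⟩

/-- **The pinned orbit exists on the shooting window.** For some `r` in the kernel-certified shooting window
`[r_d, r_u] = [17307/15625, 89409/80000]` (`Shooting.exists_meeting`: the `P₀` trajectory meets the branch through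
`P_s`; `Monatomic.leftData_all`: the 32 certified Taylor-model windows continue the branch to `P_∞`) there is a global
`C^∞` solution `(W, Z)` of the autonomous system (1.8) of Buckmaster–Cao-Labora–Gómez-Serrano (`γ = 5/3`) with
`Z < W`, `(W, Z) → P_∞ = (0, 0)`, issuing from `P₀` with the explicit analytic origin germ `OriginSeries.profile r 1`
(`A = 1`), which near some `T₀` is the analytic branch through the sonic point `P_s` (shifted to `T₀`) and has
`D_Z < 0` for `ξ < T₀`, `D_Z > 0` for `ξ > T₀`. [cite: BuckmasterCaolaboraGomezserrano2025, Thm 1.1, §6, Prop. 3.1] -/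
theorem exists_meetingWZ : ∃ r : ℝ, ((17307 / 15625 : ℝ) ≤ r ∧ r ≤ 89409 / 80000) ∧ ∃ (W Z : ℝ → ℝ) (T₀ : ℝ), ContDiff ℝ ∞ W ∧ ContDiff ℝ ∞ Z ∧ (∀ ξ, DW (W ξ) (Z ξ) * deriv W ξ = NW r (W ξ) (Z ξ) ∧ DZ (W ξ) (Z ξ) * deriv Z ξ = NZ r (W ξ) (Z ξ)) ∧ (∀ ξ, Z ξ < W ξ) ∧ Tendsto W atTop (𝓝 0) ∧ Tendsto Z atTop (𝓝 0) ∧ (∃ ε : ℝ, 0 < ε ∧ ∀ ζ ∈ Set.Ioo 0 ε, ζ * W (Real.log ζ) = OriginSeries.profile r 1 ζ ∧ -ζ * Z (Real.log ζ) = OriginSeries.profile r 1 (-ζ)) ∧ (W =ᶠ[𝓝 T₀] fun x => Wloc r (x - T₀)) ∧ (Z =ᶠ[𝓝 T₀] fun x => Zloc r (x - T₀)) ∧ (∀ ξ, ξ < T₀ → DZ (W ξ) (Z ξ) < 0) ∧ (∀ ξ, T₀ < ξ → 0 < DZ (W ξ) (Z ξ)) := by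
  obtain ⟨r, hr, hmeet⟩ := Shooting.exists_meeting
  obtain ⟨h1, h2, h3, h4, _⟩ := Shooting.window hr
  obtain ⟨_, hgerm, hode, hΩ, _, _, _⟩ := Shooting.traj_spec h1 h2
  obtain ⟨haθ, hθb, _⟩ := Shooting.θ_spec hr
  obtain ⟨hs, hall, _⟩ := Shooting.s0_spec
  obtain ⟨hsρ, hsonic⟩ := hall r hr
  obtain ⟨Wl, Zl, δ, hδ, hbranch, hl, hloff, hlimW, hlimZ⟩ := Monatomic.leftData_all r hr
  obtain ⟨W, Z, hW, hZ, heq, hWZ, hlW, hlZ, horigin, hbW, hbZ, hneg, hpos⟩ :=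
    globalWZ_of_meeting h3 h4 (𝒲 := OriginSeries.profile r 1) haθ hθb
      (fun ξ hξ => by rw [hgerm ξ hξ]; rfl) hode hΩ hs hsρ hmeet
      (fun t ht => ⟨(hsonic t ht.1 ht.2).1, (hsonic t ht.1 ht.2).2.1, (hsonic t ht.1 ht.2).2.2.1⟩)
      hδ hbranch hl hloff hlimW hlimZ
  have hr' : (17307 / 15625 : ℝ) ≤ r ∧ r ≤ 89409 / 80000 := by
    rw [Shooting.rd_eq, Shooting.ru_eq] at hr; exact hr
  exact ⟨r, hr', W, Z, Shooting.θ r - Shooting.s0, hW, hZ, heq, hWZ, hlW, hlZ,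
    ⟨Real.exp (Germ.ξA - 1), Real.exp_pos _, horigin⟩, hbW, hbZ, hneg, hpos⟩

end Summit.AtomisticToContinuum.HydrodynamicLimit.Theorems.SonicCavityRenewal

end
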